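import Mathlib.Data.Real.Basic
import Mathlib.Algebra.Order.Field.Basic
import Mathlib.Tactic.Linarith
import Mathlib.Tactic.Positivity
import Mathlib.Tactic.Ring
import Mathlib.Tactic.FieldSimp
import HarnessLib

/-!
# The multi-scale scheme of the arm-separation theorem (Nolin 2008, §4.4; Schramm–Steif 2010, Lemma A.4)

Topic: Probability / Percolation; family `crit-perc`. A brick for the discharge of the named fact
`Literature.Probability.Percolation.Nolin2008_twoArm_separation` (`ArmSeparation.lean`; Nolin,
*Near-critical percolation in two dimensions*, EJP 13 (2008), Thm. 11 [arXiv 0711.4948: Thm. 10],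
`j = 2`, `σ = BW`, `p = 1/2`), which is the only missing input of
`Literature.Probability.Percolation.Nolin2008_twoArm_quasiMult` (`ArmExponentsTwoArm.lean`; the
implication `Nolin2008_twoArm_quasiMult_of_separation` is proved in `ArmSeparationProofs.lean`).

## What is proved here

The purely real-variable **summation over dyadic scales** by which Nolin (§4.4, "The arms are
well-separated with positive probability", the displayed chain of inequalities for the external
extremities, arXiv p. 12) and Schramm–Steif (Ann. Math. 171 (2010), Appendix A, Lemma A.4) turn
three per-scale percolation estimates into the separation theorem. With `K` indexing the scales
`2^K` (outward from the inner radius `2^k`; or inward from the outer radius, the lemma being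
symmetric under reading the scales backwards) and

* `f K = P(A_{j,σ}(2^k, 2^K))` (the arm event),
* `g K = P(Ã^{·/η'}(2^k, 2^K))` (the arms *can be made* `η'`-well-separated on `∂S_{2^K}`;
  Schramm–Steif: `g_δ`, interface endpoints `δ 2^K`-apart),
* `h K = P(Ã̃^{·/η'₀, I_{η'₀}}(2^k, 2^K))` (well-separated arms landing on a fixed landing sequence;
  Schramm–Steif: `g_δ̄`),

the inputs are

* `hstep : f (K+1) ≤ g (K+1) + ε · f K` — Nolin: `A(2^k,2^{K+1}) ⊆ Ã^{·/η'}(2^k,2^{K+1}) ∪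
  ({one of the four U-shaped regions of S_{2^K,2^{K+1}} fails} ∩ A(2^k,2^K))`, independence of
  the two annuli, and Lemma 15 [arXiv Lemma 14] (`ε = 4δ`); Schramm–Steif: Lemma A.2 and
  independence on disjoint sets (`ε = C δ^ε`);
* `hland : g K ≤ C₁ · h (K+1)` — Nolin, Prop. 12 (iii) then (i) [arXiv Prop. 11]: pick a landing
  sequence `I_{η'}` (`C₁(η')`) and reach `I_{η'₀}` on the next scale (`C₂(η')`); Schramm–Steif:
  Lemma A.3 (`C₁ = 1/c(δ)`);
* `hext : h K ≤ C₀ · h (K+1)` — extension of well-separated arms at constant cost (Nolin,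
  Prop. 12 (i); Schramm–Steif, Lemma A.3 with `δ = δ̄`, `C₀ = 1/c(δ̄)`);
* `hmono : f (K+1) ≤ f K` (a longer annulus is harder to cross), `f ≤ 1`, `0 ≤ h`, and
  `hinit : c ≤ h (k+1)` (RSW at bounded ratio: Nolin, Prop. 14 [arXiv Prop. 13], lower bound);
* the smallness `ε · C₀² ≤ 1/2` ("we may have taken `δ` such that `4δ C₀ < 1/2`", Nolin; "we
  choose `δ` sufficiently small so that `δ^ε < c(δ̄)/(4C)`", Schramm–Steif) — `δ`, hence `ε`, is
  chosen after `C₀`.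

The output is `f K ≤ (2 C₁ + 1/c) · h K` for every `K ≥ k + 1`
(`le_mul_of_separationScheme`): Nolin's `P(A_{j,σ}(2^k,2^K)) ≤ C₃(η') P(Ã̃^{·/η'₀,I_{η'₀}}(2^k,2^K))`.
We ask `ε C₀² ≤ 1/2` rather than `ε C₀ < 1/2` so that a two-step induction replaces the
geometric series; this is immaterial since `δ` is chosen last.

## What is NOT here (blueprint for `Nolin2008_twoArm_separation_holds`, recorded for the prover)

The percolation inputs `hstep`, `hland`, `hext` for `j = 2`, `σ = BW` on the hexagonal annuli
of `armEvent`. For two arms of opposite colours the arm event is an *interface* event and the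
shortest printed route is Schramm–Steif's Appendix A specialised to `j = 2` (their `A_j(r,R)`,
"at least `j` crossings of alternating colors", is `armEvent ![true,false] r R` for `j = 2`):

1. interfaces crossing `Λ_R ∖ Λ̊_r` (honeycomb edge-paths with open sites on the left, closed on
   the right), their counterclockwise order, `s(r,R)` = least distance between endpoints on
   `∂Λ_R` (tree: interface walks exist for simply-connected marked domains only,
   `TriDiscInterface.lean`, `TriColourInterface.lean`);
2. the spatial Markov property "conditioned on the `i`-th interface, the far component is
   unbiased" = independence of events determined by disjoint site sets
   (`sitePercolation_inter_of_determined`, `ArmEventsProofs.lean`;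
   `infinitePi_real_inter_of_dependsOn`, `LocallyMonotoneFKG.lean`) applied to the cylinder of a
   given interface, plus the planar fact that this cylinder is determined by the sites on and
   behind it;
3. Lemma A.2, `P[s(R/2,R) < δR] ≤ C δ^ε`: RSW circuits in the `log₂(1/δ)` annuli around an
   endpoint, sampled in an independent copy glued on the unbiased component
   (`BollobasRiordan2006_openCircuit_of_rsw`, `tri_rsw_half_holds`, colour exchange
   `sitePercolation_real_preimage_compl`), and `P[≥ i interfaces] ≤ c^i` (RSW, or the iterated
   BK inequality `measureReal_disjointOccurrencePow_le` with `sitePercolation_bk`);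
4. Lemma A.3 (extension given separation): conditioned on all crossing interfaces, each sector
   carries only a monotone conditioning of its own colour, so Harris' inequality
   (`sitePercolation_harris'`, `infinitePi_harris_lower`) and RSW in bent tubes
   (`TriRSWChaining.lean`, as in `sepGlueEvent`/`sepGlue` of `ArmSeparation(Glue).lean`) extend
   the arms in disjoint, independent channels; the fences of `sepTwoArm` (`sepOuterFence`,
   `sepInnerFence`, `η = 1/64`) are further increasing events in fresh territory
   (Schramm–Steif, Remark A.7, prescribed landing arcs);
5. this file, outward for `∂Λ_N` and inward for `∂Λ_n`, and the reduction to powers of two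
   (Nolin §4.4, first display).

Nolin's own per-scale lemma (Lemma 15 [arXiv Lemma 14]: lowest crossings of U-shaped regions,
"protected" tips, tip replacement) is an alternative to 1–4; the tree's `LowestCrossing.lean`
is the `ℤ²`-bond construction and would have to be redone for `𝕋`-sites.

## References

* P. Nolin, *Near-critical percolation in two dimensions*, Electron. J. Probab. 13 (2008),
  1562–1623, §4.4 (proof of Thm. 11; arXiv 0711.4948: Thm. 10, pp. 11–12). [Nolin2008]
* O. Schramm, J. E. Steif, *Quantitative noise sensitivity and exceptional times for
  percolation*, Ann. of Math. 171 (2010), 619–672, Appendix A, Lemmas A.2–A.4, Remark A.7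
  (arXiv math/0504586, pp. 50–58). [SchrammSteif2010]
* H. Kesten, *Scaling relations for 2D-percolation*, Comm. Math. Phys. 109 (1987), 109–156
  (the original separation argument). [Kesten1987]

Mathlib search: nothing percolation-specific is used; `linarith`/`nlinarith`, ordered-field
lemmas (`le_div_iff₀`, `one_div_le_one_div_of_le`). Tree: no declaration of the tree is used
(the lemma is abstract); the names above locate the inputs for the prover of
`Nolin2008_twoArm_separation`.
-/

namespace Literature.Probability.Percolation

/-- **The multi-scale summation of the arm-separation theorem** (Nolin 2008, §4.4, proof of
Thm. 11 [arXiv 0711.4948: Thm. 10], external extremities: from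
`P(A(2^k,2^K)) ≤ P(Ã^{·/η'}(2^k,2^K)) + 4δ P(A(2^k,2^{K-1}))`, the landing/extension costs
`C₁(η')C₂(η')`, `C₀` of Prop. 12 and `4δ C₀ < 1/2`, conclude
`P(A(2^k,2^K)) ≤ C₃ P(Ã̃^{·/η'₀,I_{η'₀}}(2^k,2^K))`; the same scheme is Schramm–Steif 2010,
Lemma A.4). Abstract form: for real sequences `f, g, h` indexed by the dyadic scale `K`, if
`f ≤ 1`, `0 ≤ h`, `f (K+1) ≤ f K`, `f (K+1) ≤ g (K+1) + ε f K` (`K ≥ k`),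
`g K ≤ C₁ h (K+1)`, `h K ≤ C₀ h (K+1)` (`K ≥ k+1`), `c ≤ h (k+1)` with `c > 0`, `C₀ ≥ 1`,
`C₁, ε ≥ 0` and `ε C₀² ≤ 1/2`, then `f K ≤ (2C₁ + 1/c) h K` for all `K ≥ k+1`. [cite: Nolin2008, §4.4 (proof of Thm. 11; arXiv 0711.4948: Thm. 10)] -/
theorem le_mul_of_separationScheme {f g h : ℕ → ℝ} {k : ℕ} {ε C₀ C₁ c : ℝ}
    (hε : 0 ≤ ε) (hC₀ : 1 ≤ C₀) (hC₁ : 0 ≤ C₁) (hc : 0 < c) (hsmall : ε * C₀ ^ 2 ≤ 1 / 2)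
    (hf1 : ∀ K, f K ≤ 1) (hh0 : ∀ K, 0 ≤ h K)
    (hmono : ∀ K, k + 1 ≤ K → f (K + 1) ≤ f K)
    (hstep : ∀ K, k ≤ K → f (K + 1) ≤ g (K + 1) + ε * f K)
    (hland : ∀ K, k + 1 ≤ K → g K ≤ C₁ * h (K + 1))
    (hext : ∀ K, k + 1 ≤ K → h K ≤ C₀ * h (K + 1))
    (hinit : c ≤ h (k + 1)) :
    ∀ K, k + 1 ≤ K → f K ≤ (2 * C₁ + 1 / c) * h K := by
  set M : ℝ := 2 * C₁ + 1 / c with hM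
  have hc' : 0 < 1 / c := one_div_pos.2 hc
  have hM0 : 0 ≤ M := by positivity
  have hMc : 1 / c ≤ M := by rw [hM]; linarith
  have hC₀0 : 0 ≤ C₀ := le_trans zero_le_one hC₀
  have hεC₀ : ε * C₀ ≤ 1 / 2 := by
    have h1 : 0 ≤ ε * C₀ * (C₀ - 1) := mul_nonneg (mul_nonneg hε hC₀0) (by linarith)
    nlinarith [h1, hsmall]
  -- the first scale: `f ≤ 1 ≤ h (k+1) / c`
  have base1 : f (k + 1) ≤ M * h (k + 1) := by
    have h1 : (1 : ℝ) ≤ 1 / c * h (k + 1) := by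
      rw [one_div_mul_eq_div, le_div_iff₀ hc, one_mul]
      exact hinit
    calc f (k + 1) ≤ 1 := hf1 _
      _ ≤ 1 / c * h (k + 1) := h1
      _ ≤ M * h (k + 1) := mul_le_mul_of_nonneg_right hMc (hh0 _)
  -- the second scale: `f (k+2) ≤ f (k+1) ≤ g (k+1) + ε ≤ C₁ h (k+2) + ε C₀ h (k+2) / c`
  have base2 : f (k + 2) ≤ M * h (k + 2) := by
    have s1 : f (k + 2) ≤ f (k + 1) := hmono (k + 1) le_rfl
    have s2 : f (k + 1) ≤ g (k + 1) + ε * f k := hstep k le_rfl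
    have s3 : g (k + 1) ≤ C₁ * h (k + 2) := hland (k + 1) le_rfl
    have s4 : ε * f k ≤ ε := by nlinarith [hf1 k, hε]
    have hh2 : c ≤ C₀ * h (k + 2) := hinit.trans (hext (k + 1) le_rfl)
    have s5 : ε ≤ 1 / (2 * c) * h (k + 2) := by
      rw [one_div_mul_eq_div, le_div_iff₀ (by positivity)]
      have e1 : ε * (2 * c) ≤ ε * (2 * (C₀ * h (k + 2))) :=
        mul_le_mul_of_nonneg_left (by linarith) hε
      have e2 : ε * (2 * (C₀ * h (k + 2))) = (2 * (ε * C₀)) * h (k + 2) := by ring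
      have e3 : (2 * (ε * C₀)) * h (k + 2) ≤ 1 * h (k + 2) :=
        mul_le_mul_of_nonneg_right (by linarith) (hh0 _)
      linarith
    have s6 : 1 / (2 * c) * h (k + 2) ≤ 1 / c * h (k + 2) :=
      mul_le_mul_of_nonneg_right (one_div_le_one_div_of_le hc (by linarith)) (hh0 _)
    have s7 : 0 ≤ C₁ * h (k + 2) := mul_nonneg hC₁ (hh0 _)
    have : f (k + 2) ≤ C₁ * h (k + 2) + 1 / c * h (k + 2) := by linarith
    calc f (k + 2) ≤ C₁ * h (k + 2) + 1 / c * h (k + 2) := this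
      _ ≤ M * h (k + 2) := by rw [hM]; nlinarith [s7]
  -- the two-step induction: `f K ≤ M h K ⟹ f (K+2) ≤ M h (K+2)`
  have step : ∀ K, k + 1 ≤ K → f K ≤ M * h K → f (K + 2) ≤ M * h (K + 2) := by
    intro K hK hfK
    have s1 : f (K + 2) ≤ f (K + 1) := hmono (K + 1) (Nat.le_succ_of_le hK)
    have s2 : f (K + 1) ≤ g (K + 1) + ε * f K := hstep K ((Nat.le_succ _).trans hK)
    have s3 : g (K + 1) ≤ C₁ * h (K + 2) := hland (K + 1) (Nat.le_succ_of_le hK)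
    have s4 : h K ≤ C₀ ^ 2 * h (K + 2) :=
      calc h K ≤ C₀ * h (K + 1) := hext K hK
        _ ≤ C₀ * (C₀ * h (K + 2)) :=
          mul_le_mul_of_nonneg_left (hext (K + 1) (Nat.le_succ_of_le hK)) hC₀0
        _ = C₀ ^ 2 * h (K + 2) := by ring
    have s5 : ε * f K ≤ ε * (M * (C₀ ^ 2 * h (K + 2))) :=
      mul_le_mul_of_nonneg_left (hfK.trans (mul_le_mul_of_nonneg_left s4 hM0)) hε
    have s6 : ε * (M * (C₀ ^ 2 * h (K + 2))) = (ε * C₀ ^ 2) * (M * h (K + 2)) := by ring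
    have s7 : (ε * C₀ ^ 2) * (M * h (K + 2)) ≤ 1 / 2 * (M * h (K + 2)) :=
      mul_le_mul_of_nonneg_right hsmall (mul_nonneg hM0 (hh0 _))
    have s8 : C₁ * h (K + 2) ≤ 1 / 2 * (M * h (K + 2)) := by
      have e : 1 / 2 * (M * h (K + 2)) = C₁ * h (K + 2) + 1 / (2 * c) * h (K + 2) := by
        rw [hM]; field_simp
      rw [e]
      have : 0 ≤ 1 / (2 * c) * h (K + 2) := mul_nonneg (by positivity) (hh0 _)
      linarith
    linarith
  have pair : ∀ d, f (k + 1 + d) ≤ M * h (k + 1 + d) ∧ f (k + 1 + d + 1) ≤ M * h (k + 1 + d + 1) := by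
    intro d
    induction d with
    | zero => exact ⟨base1, base2⟩
    | succ d ih => exact ⟨ih.2, step (k + 1 + d) (Nat.le_add_right _ _) ih.1⟩
  intro K hK
  obtain ⟨d, rfl⟩ : ∃ d, K = k + 1 + d := ⟨K - (k + 1), by omega⟩
  exact (pair d).1

/-- The same scheme with the conclusion constant named: there is `C₃ = 2C₁ + 1/c > 0`,
depending only on the costs, with `f K ≤ C₃ h K` for all `K ≥ k+1` (Nolin 2008, §4.4:
"`P(A_{j,σ}(2^k,2^K)) ≤ C₃(η') P(Ã̃^{·/η'₀,I_{η'₀}}(2^k,2^K))`"). [cite: Nolin2008, §4.4 (proof of Thm. 11; arXiv 0711.4948: Thm. 10)] -/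
theorem exists_le_mul_of_separationScheme {f g h : ℕ → ℝ} {k : ℕ} {ε C₀ C₁ c : ℝ}
    (hε : 0 ≤ ε) (hC₀ : 1 ≤ C₀) (hC₁ : 0 ≤ C₁) (hc : 0 < c) (hsmall : ε * C₀ ^ 2 ≤ 1 / 2)
    (hf1 : ∀ K, f K ≤ 1) (hh0 : ∀ K, 0 ≤ h K)
    (hmono : ∀ K, k + 1 ≤ K → f (K + 1) ≤ f K)
    (hstep : ∀ K, k ≤ K → f (K + 1) ≤ g (K + 1) + ε * f K)
    (hland : ∀ K, k + 1 ≤ K → g K ≤ C₁ * h (K + 1))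
    (hext : ∀ K, k + 1 ≤ K → h K ≤ C₀ * h (K + 1))
    (hinit : c ≤ h (k + 1)) :
    ∃ C₃ : ℝ, 0 < C₃ ∧ ∀ K, k + 1 ≤ K → f K ≤ C₃ * h K :=
  ⟨2 * C₁ + 1 / c, by positivity,
    le_mul_of_separationScheme hε hC₀ hC₁ hc hsmall hf1 hh0 hmono hstep hland hext hinit⟩

end Literature.Probability.Percolation
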